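import Literature.Topology.FourManifolds.BoxUnstableSet
import Literature.Topology.FourManifolds.SlabLevelRetraction
import HarnessLib

/-!
# The trace of the unstable set of a top critical point on a slab is closed
# (Milnor 1965, Thm. 4.1: "the compact set `K_p` of points on trajectories going to or from `p`")

Topic `Literature/Topology/FourManifolds`; a brick for the fact seat
`provefact-Literature.Topology.FourManifolds.Cobordism.Milnor1965_exists_isolatedPair_middle`
(one-slide step of the Basis Theorem 7.6 on a slab).  To read off a class of `H_k(W, V)` from its
localisations at the right-hand discs (`LocalisationInjective.lean`, `SlabBottomRetraction.lean`)
the pieces `W^u(p) ∩ S` of the obstruction set must be CLOSED and pairwise disjoint.  Milnor,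
*Lectures on the h-cobordism theorem* (1965), Thm. 4.1 (PDF p. 22) works with one critical level,
where *"the compact set `K_p`"* is indeed compact; in general `W^u(p) ∩ S` accumulates on the
unstable sets of the critical points which trajectories from `p` approach.  This file proves
closedness for a critical point `p` which is **top** among the critical points of the sub-slab
(`f q ≤ f p` for every critical `q` with `b < f q ≤ b'`), the situation of Thm. 7.6 before the
slide (all critical points of the slab on one level):

* `SlabFlow.isClosed_unstableSet_inter_slab` — for a slab flow on `f⁻¹[a₀, a₁]`, a sub-slab
  `S = f⁻¹[b, b']` with regular bottom level, and a top critical point `p` of `S`, the set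
  `{x ∈ S | x ∈ W^u(p)}` is closed.  (A limit point lies on some `W^u(q)` by compactness of the
  obstruction set; if `q ≠ p`, nearby points of `W^u(p)` would pass through the neighbourhood
  `{|x⃗|² |y⃗|² < ε⁴}` of `q` in its Milnor box, whence — by the backward exit lemma of
  `BoxUnstableSet.lean` — through points of value `< f q ≤ f p`, impossible on `W^u(p)`.)

Everything is proved; no definitions, no named facts.

## References

* J. Milnor, *Lectures on the h-cobordism theorem*, notes by L. Siebenmann and J. Sondow,
  Princeton Mathematical Notes (1965), Thm. 4.1 and its proof (PDF p. 22), Def. 3.1 (2) and the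
  proof of Thm. 3.12 (PDF pp. 12, 18), proof of Thm. 7.6 (PDF p. 50).  Held:
  `lit read book:milnornd-lectures-h-cobordism-theorem`. [MilnorHCobordism1965]
-/

open scoped Manifold ContDiff Topology
open Set Function Filter unitInterval

noncomputable section

namespace Literature.Topology.FourManifolds

universe u

variable {n : ℕ} {M N : Type u} [TopologicalSpace M] [ChartedSpace (EuclideanSpace ℝ (Fin n)) M]
  [TopologicalSpace N] [ChartedSpace (EuclideanSpace ℝ (Fin n)) N]
  {c : Cobordism n M N} {f : c.W → ℝ} {ξ : Π x : c.W, TangentSpace (𝓡∂ (n + 1)) x}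
  {a₀ a₁ : ℝ} {θ : ℝ × c.W → c.W}

namespace Cobordism

open FourManifolds.Flow

namespace SlabFlow

/-- Along a flow line coming from `p`, `f` is at least `f p` (`f` does not decrease along the
flow and tends to `f p` backward in time). [cite: MilnorHCobordism1965, Def. 3.1, Def. 3.9] -/
theorem apply_le_of_tendsto_atBot (h : SlabFlow c f ξ a₀ a₁ θ) {p w : c.W}
    (hw : Tendsto (fun t => θ (t, w)) atBot (𝓝 p)) : f p ≤ f w := by
  have hlim : Tendsto (fun t => f (θ (t, w))) atBot (𝓝 (f p)) :=
    (h.contMDiff_f.continuous.tendsto p).comp hw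
  have hle : ∀ᶠ t in atBot, f (θ (t, w)) ≤ f w := by
    filter_upwards [eventually_le_atBot (0 : ℝ)] with t ht
    have := h.monotone w ht
    simpa [h.isSmoothFlow.map_zero] using this
  exact le_of_tendsto hlim hle

/-- A point on the orbit of a point coming from `p` comes from `p`. [folklore] -/
theorem tendsto_atBot_apply (h : SlabFlow c f ξ a₀ a₁ θ) {p y : c.W}
    (hy : Tendsto (fun t => θ (t, y)) atBot (𝓝 p)) (t₀ : ℝ) :
    Tendsto (fun t => θ (t, θ (t₀, y))) atBot (𝓝 p) := by
  have h1 := hy.comp (tendsto_atBot_add_const_right atBot t₀ tendsto_id)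
  refine h1.congr fun s => ?_
  simp only [comp_apply, id_eq, h.isSmoothFlow.map_add]

/-- **The trace on a sub-slab of the unstable set of a top critical point is closed** (Milnor
1965, Thm. 4.1: `K_p` is compact when no other critical level interferes).  Setting: a slab
flow on `f⁻¹[a₀, a₁]`; a sub-slab `S = f⁻¹[b, b']`, `a₀ < b ≤ b' < a₁`, whose bottom level `b`
carries no critical point; a critical point `p` with `b < f p ≤ b'` such that `f q ≤ f p` for
every critical `q` with `b < f q ≤ b'`.  Then `{x ∈ S | x ∈ W^u(p)}` is closed.
[cite: MilnorHCobordism1965, Thm. 4.1 (PDF p. 22); Def. 3.1 (2), proof of Thm. 3.12 (PDF pp. 12, 18)] -/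
theorem isClosed_unstableSet_inter_slab (h : SlabFlow c f ξ a₀ a₁ θ) {b b' : ℝ} (hb : a₀ < b)
    (hbb' : b ≤ b') (hb' : b' < a₁) (hreg : ∀ x, f x = b → ¬ IsMCriticalPt (𝓡∂ (n + 1)) f x)
    {p : c.W} (hp : IsMCriticalPt (𝓡∂ (n + 1)) f p) (hbp : b < f p) (hpb' : f p ≤ b')
    (htop : ∀ q, IsMCriticalPt (𝓡∂ (n + 1)) f q → b < f q → f q ≤ b' → f q ≤ f p) :
    IsClosed {x : c.W | f x ∈ Icc b b' ∧ x ∈ unstableSet (𝓡∂ (n + 1)) ξ p} := by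
  have hflow : IsFlowOf (𝓡∂ (n + 1)) (slabField f ξ a₀ a₁) θ := h.isSmoothFlow.isFlowOf
  -- the set lies in the (closed) obstruction set above `b`, cut at `b'`
  set T : Set c.W := {x | f x ∈ Icc b b' ∧ x ∈ unstableSet (𝓡∂ (n + 1)) ξ p} with hT
  have hKc : IsClosed {x : c.W | f x ∈ Icc b a₁ ∧
      ∃ q, IsMCriticalPt (𝓡∂ (n + 1)) f q ∧ b < f q ∧ x ∈ unstableSet (𝓡∂ (n + 1)) ξ q} :=
    (h.isCompact_obstruction hb (hbb'.trans hb'.le) hreg).isClosed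
  have hIc : IsClosed (f ⁻¹' Icc b b') := isClosed_Icc.preimage h.contMDiff_f.continuous
  have hTsub : T ⊆ {x : c.W | f x ∈ Icc b a₁ ∧
      ∃ q, IsMCriticalPt (𝓡∂ (n + 1)) f q ∧ b < f q ∧ x ∈ unstableSet (𝓡∂ (n + 1)) ξ q} ∩
      f ⁻¹' Icc b b' :=
    fun x hx => ⟨⟨⟨hx.1.1, hx.1.2.trans hb'.le⟩, p, hp, hbp, hx.2⟩, hx.1⟩
  refine isClosed_of_closure_subset fun x hx => ?_
  obtain ⟨⟨-, q, hq, hbq, hxq⟩, hfx⟩ := (closure_minimal hTsub (hKc.inter hIc)) hx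
  have hfx' : f x ∈ Icc b b' := hfx
  -- `q` is below `p`
  have hqx : f q ≤ f x := apply_le_of_mem_unstableSet h.mdifferentiable_f h.mlineDeriv_pos hxq
  have hqb' : f q ≤ b' := hqx.trans hfx'.2
  have hqp_le : f q ≤ f p := htop q hq hbq hqb'
  by_cases hqp : q = p
  · subst hqp; exact ⟨hfx', hxq⟩
  exfalso
  -- the Milnor box of `q` for the cut-off field, inside the open slab
  have hqI : f q ∈ Icc a₀ a₁ := ⟨hb.le.trans hbq.le, hqb'.trans hb'.le⟩
  have hqint : (𝓡∂ (n + 1)).IsInteriorPoint q := h.isInteriorPoint_of_mem_Icc hqI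
  have hO : IsOpen (f ⁻¹' Ioo a₀ a₁) := isOpen_Ioo.preimage h.contMDiff_f.continuous
  have hqO : q ∈ f ⁻¹' Ioo a₀ a₁ := ⟨hb.trans hbq, hqb'.trans_lt hb'⟩
  obtain ⟨D, -⟩ := h.isGradientLike.exists_milnorBox_source_subset
    (X := slabField f ξ a₀ a₁) hq hqint hO hqO fun y hy => h.slabField_eq (Ioo_subset_Icc_self hy)
  have hε := D.eps_pos
  -- the neighbourhood `U = {|x⃗|² |y⃗|² < ε⁴}` of `q` in the box
  set P : c.W → ℝ := fun w => sqSumLT D.k (D.coord w) * sqSumGE D.k (D.coord w) with hP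
  have hPc : ContinuousOn P D.chart.source := D.continuousOn_sqSum_coord.1.mul D.continuousOn_sqSum_coord.2
  set U : Set c.W := D.box ∩ (D.chart.source ∩ P ⁻¹' Iio (D.ε ^ 4)) with hU
  have hUo : IsOpen U := D.isOpen_box.inter (hPc.isOpen_inter_preimage D.chart.open_source isOpen_Iio)
  have hqU : q ∈ U := by
    refine ⟨D.mem_box_self, D.mem_source, ?_⟩
    show P q < D.ε ^ 4
    simp only [hP, D.coord_self, sqSumLT, sqSumGE]
    simp [pow_pos hε 4]
  -- the orbit of `x` enters `U`
  have hx_t : Tendsto (fun t => θ (t, x)) atBot (𝓝 q) :=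
    (h.mem_unstableSet_iff_tendsto (hfx'.2.trans hb'.le) hqI.1).1 hxq
  obtain ⟨t₀, ht₀⟩ := (hx_t.eventually (hUo.mem_nhds hqU)).exists
  -- so do nearby points of `W^u(p) ∩ S`
  have hopen : IsOpen ((fun y => θ (t₀, y)) ⁻¹' U) :=
    hUo.preimage (h.isSmoothFlow.continuous.comp (Continuous.prodMk_right t₀))
  obtain ⟨y, hyU, hyT⟩ := mem_closure_iff.1 hx _ hopen ht₀
  have hpI : f p ∈ Icc a₀ a₁ := ⟨hb.le.trans hbp.le, hpb'.trans hb'.le⟩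
  have hy_t : Tendsto (fun t => θ (t, y)) atBot (𝓝 p) :=
    (h.mem_unstableSet_iff_tendsto (hyT.1.2.trans hb'.le) hpI.1).1 hyT.2
  set w : c.W := θ (t₀, y) with hw_def
  have hwU : w ∈ U := hyU
  have hw_t : Tendsto (fun t => θ (t, w)) atBot (𝓝 p) := h.tendsto_atBot_apply hy_t t₀
  by_cases hA : sqSumLT D.k (D.coord w) = 0
  · -- `w` also comes from `q`: `p = q`
    have hwq := D.tendsto_atBot_of_sqSumLT_eq_zero_of_mem_box hflow hwU.1 hA
    exact hqp (tendsto_nhds_unique hwq hw_t)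
  · -- `w` entered the box through `|x⃗|² = ε²` at a point of value `< f q ≤ f p`
    have hApos : 0 < sqSumLT D.k (D.coord w) := lt_of_le_of_ne (sqSumLT_nonneg _ _) (Ne.symm hA)
    obtain ⟨Tb, hTb0, hin, hATb, hcons⟩ := D.exists_backward_exit hflow hwU.1 hApos
    have hBlt : sqSumGE D.k (D.coord (θ (-Tb, w))) < D.ε ^ 2 := by
      have hPw : P w < D.ε ^ 4 := hwU.2.2
      have h2 : 0 < D.ε ^ 2 := by positivity
      nlinarith [hcons, hPw]
    have hval : f (θ (-Tb, w)) < f q := by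
      rw [D.apply_eq_of_mem_source (hin (-Tb) ⟨le_rfl, by linarith⟩).1, hATb]
      linarith
    have hge : f p ≤ f (θ (-Tb, w)) := h.apply_le_of_tendsto_atBot (h.tendsto_atBot_apply hw_t (-Tb))
    linarith

end SlabFlow

end Cobordism

end Literature.Topology.FourManifolds

end
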